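import Literature.Probability.FitznerVanDerHofstad2017.Stage1TailsRem
import Literature.Probability.FitznerVanDerHofstad2017.Stage1CellsST10   -- HOME draft typed/p13/Stage1CellsST10Q_DRAFT.lean (module name TBD by the Level-C lead)
import HarnessLib

/-!
# HOME DRAFT (pub-lace10 typer g6, 2026-08-23; NOT filed — lead RULING D29 (3)) — P1.3 «RECIPE ASSEMBLY», rational side:
# `Stage1Tails.Rem.ST10`, the `N ≥ 4` tail ingredients and the rational MAJORANT RECORD `inpMajQ` over the ST10′ composite `Stage1Cells.Rem.ST10`

GENERATED by `typed/p13/gen_tails_st10.py` (wb=hookQ) from the TREE text `Stage1TailsRem.lean` sha256 4e09279c932cd4b0… (§ Frame l.48–61, § RatFrame l.307–370) with exactly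
these substitutions: `Stage1Cells.Rem.X P ρ ↦ Stage1Cells.Rem.ST10.X P ρ` for every cell X the composite DECLARES (its 14 leaves, 2 inserted, 75 closure re-declarations —
`typed/p13/census_hookQ.txt`; every other cell keeps its tree name), `E.evRm P ρ ↦ E.evRmST P ρ χ`, `E.inpRm P ρ ↦ E.inpRmST P ρ χ`, the [C-22] point hook `χ : Pt → StateQ → ℚ` threaded through `evVQ/evMQ/ingrQ/tailValQ/inpMajQ`.  Pattern = landed `Stage1TailsDplusD10` §1
(`Stage1Tails.Rem.Dplus.{H3PEAhE,H2PEAhE,C2BbarBC1,evVQ,evMQ,ingrQ,tailValQ}`) + `Stage1BetaD10Dplus.inpMajQ`; `hSAtNR` is re-bound too because the composite re-declares `hS`.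
NOT in this file (Level-C day 1 / P2.3, as in the D27 precedent): the real-side record `ingr/inpT/inpFull/inpMaj` over a typed frame and the cast / domination lemmas
(`Stage1TailsRem` § Frame :63–300 verbatim over `Data.evRmST` once that exists), the Neumann certificates and the tail brackets at (P40, ρ40, stateRev3) (eng generator v2/v3).
HONEST FRAMING: d-generic text; no numeral, no table instance, no kernel evaluation, no percolation claim; every `[cite:]` tag is the LOCATOR of the re-bound cell's text.
-/

namespace Literature.Probability.FitznerVanDerHofstad2017
namespace Stage1Tails.Rem.ST10

open Stage1Cells NoGoFrame BetaMap

noncomputable section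

/-! ## §T1 The tail ingredients over the composite (texts of `Stage1TailsRem` § Frame, re-bound) -/

/-- (ST10′ composite: text of `Stage1TailsRem` l.52 re-bound over `Stage1Cells.Rem.ST10 · ρ`) `h^S.AiotaNonRepᵀ` (cell 42; cells 38–40 use `Aiota` here, cell 42 prints `AiotaNonRep`). [cite: FitznerVanDerHofstad2017, notebook Percolation.nb cell 42 (transcript l.1161–1164)] -/
def hSAtNR (P : Params) (ρ : Fin 10 → T) : Vec := vecMul (Stage1Cells.Rem.ST10.hS P ρ) (tr (Stage1Cells.Rem.AiotaNR P ρ))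

/-- (ST10′ composite: text of `Stage1TailsRem` l.55 re-bound over `Stage1Cells.Rem.ST10 · ρ`) `H₃.P^E + AiotaNonRep.h^E` (cell 42). [cite: FitznerVanDerHofstad2017, notebook Percolation.nb cell 42 (transcript l.1161–1169)] -/
def H3PEAhE (P : Params) (ρ : Fin 10 → T) : Vec := vadd (Stage1Cells.mulVec (Stage1Cells.Rem.ST10.H3 P ρ) (Stage1Cells.Rem.ST10.PE P ρ)) (Stage1Cells.mulVec (Stage1Cells.Rem.AiotaNR P ρ) (Stage1Cells.Rem.ST10.hE P ρ))

/-- (ST10′ composite: text of `Stage1TailsRem` l.58 re-bound over `Stage1Cells.Rem.ST10 · ρ`) `H₂.P^E + AiotaNonRep.h^E` (cell 42). [cite: FitznerVanDerHofstad2017, notebook Percolation.nb cell 42 (transcript l.1167–1170)] -/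
def H2PEAhE (P : Params) (ρ : Fin 10 → T) : Vec := vadd (Stage1Cells.mulVec (Stage1Cells.Rem.ST10.H2 P ρ) (Stage1Cells.Rem.ST10.PE P ρ)) (Stage1Cells.mulVec (Stage1Cells.Rem.AiotaNR P ρ) (Stage1Cells.Rem.ST10.hE P ρ))

/-- (ST10′ composite: text of `Stage1TailsRem` l.61 re-bound over `Stage1Cells.Rem.ST10 · ρ`) `C₂.B̄ + B.C₁` (cell 42). [cite: FitznerVanDerHofstad2017, notebook Percolation.nb cell 42 (transcript l.1166–1169)] -/
def C2BbarBC1 (P : Params) (ρ : Fin 10 → T) : Mat := madd (matMul (Stage1Cells.Rem.ST10.C2 P ρ) (Stage1Cells.Rem.ST10.Bbar P ρ)) (matMul (Stage1Cells.Rem.ST10.B P ρ) (Stage1Cells.Rem.ST10.C1 P ρ))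

/-! ## §T2 The rational ingredient record, the closed-form tail value and THE RATIONAL MAJORANT RECORD over the composite (texts of `Stage1TailsRem` § RatFrame, re-bound) -/

/-- (ST10′ composite: text of `Stage1TailsRem` l.307 re-bound over `Stage1Cells.Rem.ST10 · ρ`, hook χ) a typed vector of cells as a rational vector at `(s, y)` over the data `E`, cells evaluated by `DataQ.evRmST · ρ χ`. [cite: FitznerVanDerHofstad2017, notebook Percolation.nb cells 41–44 (transcript l.1131–1237)] -/
def evVQ (E : DataQ) (P : Params) (ρ : Fin 10 → T) (χ : Pt → StateQ → ℚ) (s : Pt) (y : StateQ) (v : Vec) : Fin 3 → ℚ := fun a => E.evRmST P ρ χ s y (v a)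

/-- (ST10′ composite: text of `Stage1TailsRem` l.310 re-bound over `Stage1Cells.Rem.ST10 · ρ`, hook χ) a typed matrix of cells as a rational matrix at `(s, y)` over the data `E`, cells evaluated by `DataQ.evRmST · ρ χ`. [cite: FitznerVanDerHofstad2017, notebook Percolation.nb cells 41–44 (transcript l.1131–1237)] -/
def evMQ (E : DataQ) (P : Params) (ρ : Fin 10 → T) (χ : Pt → StateQ → ℚ) (s : Pt) (y : StateQ) (Mx : Mat) : Matrix (Fin 3) (Fin 3) ℚ :=
  Matrix.of fun a b => E.evRmST P ρ χ s y (Mx a b)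

/-- (ST10′ composite: text of `Stage1TailsRem` l.314 re-bound over `Stage1Cells.Rem.ST10 · ρ`, hook χ) the rational ingredients of cells 41–42 over the data `E` at `(s, y)` (mirror of `ingr`). [cite: FitznerVanDerHofstad2017, notebook Percolation.nb cells 41–44 (transcript l.1131–1237)] -/
def ingrQ (E : DataQ) (P : Params) (ρ : Fin 10 → T) (χ : Pt → StateQ → ℚ) (s : Pt) (y : StateQ) : IngrQ (Fin 3) where
  u := fun
    | .PS => evVQ E P ρ χ s y (Stage1Cells.Rem.ST10.PS P ρ)
    | .Piota => evVQ E P ρ χ s y (Stage1Cells.Rem.ST10.Piota P ρ)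
    | .hSAtNR => evVQ E P ρ χ s y (hSAtNR P ρ)
    | .hII => evVQ E P ρ χ s y (Stage1Cells.Rem.ST10.hII P ρ)
  m := fun
    | .AbarNR => evMQ E P ρ χ s y (Stage1Cells.Rem.AiotabarNR P ρ)
    | .one => 1
    | .C1 => evMQ E P ρ χ s y (Stage1Cells.Rem.ST10.C1 P ρ)
    | .C2 => evMQ E P ρ χ s y (Stage1Cells.Rem.ST10.C2 P ρ)
    | .C1BbBC2 => evMQ E P ρ χ s y (Stage1Cells.Rem.ST10.C1BbarBC2 P ρ)
    | .C2BbBC1 => evMQ E P ρ χ s y (C2BbarBC1 P ρ)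
  w := fun
    | .PE => evVQ E P ρ χ s y (Stage1Cells.Rem.ST10.PE P ρ)
    | .H3PEAhE => evVQ E P ρ χ s y (H3PEAhE P ρ)
    | .H2PEAhE => evVQ E P ρ χ s y (H2PEAhE P ρ)
  B := evMQ E P ρ χ s y (Stage1Cells.Rem.ST10.B P ρ)
  Bb := evMQ E P ρ χ s y (Stage1Cells.Rem.ST10.Bbar P ρ)

/-- (ST10′ composite: text of `Stage1TailsRem` l.335 re-bound over `Stage1Cells.Rem.ST10 · ρ`, hook χ) the rational value of a cell-41/42 table under the closed-form reading at `S`, `S̄`. [cite: FitznerVanDerHofstad2017, notebook Percolation.nb cells 41–44 (transcript l.1131–1237)] -/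
def tailValQ (E : DataQ) (P : Params) (ρ : Fin 10 → T) (χ : Pt → StateQ → ℚ) (y : StateQ) (s : Pt) (S Sb : Matrix (Fin 3) (Fin 3) ℚ)
    (l : List Piece) : ℚ :=
  totalQ S Sb (ingrQ E P ρ χ s y) l

/-- (ST10′ composite: text of `Stage1TailsRem` l.341 re-bound over `Stage1Cells.Rem.ST10 · ρ`, hook χ) THE RATIONAL MAJORANT RECORD: `Stage1Cells.DataQ.inpRmST · ρ χ` with the closed-form tails at `S s`, `S̄ s` added to the
twenty-two tail fields, literally as in `inpT`. [cite: FitznerVanDerHofstad2017, notebook Percolation.nb cells 41–44 (transcript l.1131–1237)] -/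
def inpMajQ (E : DataQ) (P : Params) (ρ : Fin 10 → T) (χ : Pt → StateQ → ℚ) (y : StateQ) (s : Pt) (S Sb : Pt → Matrix (Fin 3) (Fin 3) ℚ) : Inputs :=
  let tv : List Piece → ℝ := fun l => ((tailValQ E P ρ χ y s (S s) (Sb s) l : ℚ) : ℝ)
  { E.inpRmST P ρ χ y s with
    xiAbs := (E.inpRmST P ρ χ y s).xiAbs + (tv Tail.xiOdd + tv Tail.xiEven)
    xiOdd := (E.inpRmST P ρ χ y s).xiOdd + tv Tail.xiOdd
    xiEven := (E.inpRmST P ρ χ y s).xiEven + tv Tail.xiEven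
    xiEvenTail := (E.inpRmST P ρ χ y s).xiEvenTail + tv Tail.xiEven
    xiOddTail := (E.inpRmST P ρ χ y s).xiOddTail + tv Tail.xiOdd
    xiDeltaAbs := (E.inpRmST P ρ χ y s).xiDeltaAbs + (tv Tail.xiOddDelta + tv Tail.xiEvenDelta)
    xiOddDelta := (E.inpRmST P ρ χ y s).xiOddDelta + tv Tail.xiOddDelta
    xiEvenDelta := (E.inpRmST P ρ χ y s).xiEvenDelta + tv Tail.xiEvenDelta
    xiOddTailDelta := (E.inpRmST P ρ χ y s).xiOddTailDelta + tv Tail.xiOddDelta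
    xiEvenTailDelta := (E.inpRmST P ρ χ y s).xiEvenTailDelta + tv Tail.xiEvenDelta
    xiIotaAbs := (E.inpRmST P ρ χ y s).xiIotaAbs + (tv Tail.xiIotaOdd + tv Tail.xiIotaEven)
    xiIotaOdd := (E.inpRmST P ρ χ y s).xiIotaOdd + tv Tail.xiIotaOdd
    xiIotaEven := (E.inpRmST P ρ χ y s).xiIotaEven + tv Tail.xiIotaEven
    xiIotaEvenTail := (E.inpRmST P ρ χ y s).xiIotaEvenTail + tv Tail.xiIotaEven
    xiIotaDeltaEi := (E.inpRmST P ρ χ y s).xiIotaDeltaEi + (tv Tail.xiIotaOddDeltaEi + tv Tail.xiIotaEvenDeltaEi)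
    xiIotaOddDeltaEi := (E.inpRmST P ρ χ y s).xiIotaOddDeltaEi + tv Tail.xiIotaOddDeltaEi
    xiIotaEvenDeltaEi := (E.inpRmST P ρ χ y s).xiIotaEvenDeltaEi + tv Tail.xiIotaEvenDeltaEi
    xiIotaEvenTailDeltaEi := (E.inpRmST P ρ χ y s).xiIotaEvenTailDeltaEi + tv Tail.xiIotaEvenDeltaEi
    xiIotaDeltaZero := (E.inpRmST P ρ χ y s).xiIotaDeltaZero
      + (tv Tail.xiIotaOddDeltaZero + tv Tail.xiIotaEvenDeltaZero)
    xiIotaOddDeltaZero := (E.inpRmST P ρ χ y s).xiIotaOddDeltaZero + tv Tail.xiIotaOddDeltaZero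
    xiIotaEvenDeltaZero := (E.inpRmST P ρ χ y s).xiIotaEvenDeltaZero + tv Tail.xiIotaEvenDeltaZero
    xiIotaEvenTailDeltaZero := (E.inpRmST P ρ χ y s).xiIotaEvenTailDeltaZero + tv Tail.xiIotaEvenDeltaZero }

end

end Stage1Tails.Rem.ST10
end Literature.Probability.FitznerVanDerHofstad2017
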